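import Literature.AnabelianGeometry.AbsoluteAnabelian.NeukirchUchidaUniquenessProofs
import HarnessLib

/-!
# Neukirch–Uchida, row R12 (TRANSPORT-TO-F): from the `ℚ`-core inside `Γ = Gal(ℚ̄/ℚ)` to `NeukirchUchida F`

Classical algebraic number theory (abc-iut cell, campaign L, GAP row G-L4d2g4-1, `plan/L4/SUBDAG-NeukirchUchida.md`
row **R12 TRANSPORT-TO-F**, §INTERFACES v2; holder abc-iut-w6-d055 by abc-iut-L4-d2's GO 13:25:01Z).

The sub-DAG proves, inside the one closure `Ω₀ = AlgebraicClosure ℚ` with `Γ = absoluteGaloisGroup ℚ`, the `ℚ`-CORE: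
«for open `U₁ U₂ ≤ Γ` and a topological isomorphism `α : U₁ ⥲ U₂` satisfying the (12.1.9)-containment (H) for `α`
and `α⁻¹`, there is `τ ∈ Γ` with `α(u) = τ u τ⁻¹`» (rows R1–R11).  The tree's NAMED FACT is stated for an ARBITRARY
number field `F` with its own closure (`Literature.NumberTheory.GaloisRepresentations.NeukirchUchida F`, p437013):
«for open `U₁ U₂ ≤ G_F` and `α : U₁ ⥲ U₂` there is a FIELD automorphism `τ` of `F̄` with `α(u) ∘ τ = τ ∘ u`».
THIS FILE is the transport between the two — `theorem neukirchUchida_of_ratCore`: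

  `(h1219 : (12.1.9) at base ℚ, containment form, for every open U₁ U₂ ≤ Γ and every α)`
  `→ (hcore : the ℚ-core, ∃-form, hypotheses (H α) (H α⁻¹) spelled EXACTLY as in row R1 p446402)`
  `→ ∀ F number field, NeukirchUchida F`.

MECHANISM.  `j_F : G_F →ₜ* Γ`, `σ ↦ e ∘ σ|_ℚ ∘ e⁻¹` for the `ℚ`-isomorphism `e : AlgebraicClosure F ≃ₐ[ℚ] Ω₀`
(`IsAlgClosure.equiv`; `j_F` = Mathlib's `AlgEquiv.restrictScalarsHom ℚ` followed by the tree's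
`algEquivContinuousMulEquivAbsoluteGaloisGroup ℚ (AlgebraicClosure F)`), continuous (Krull: `restrictScalars` is continuous,
`continuous_restrictScalarsHom`), injective, mapping open subgroups to open subgroups (abc-iut-w4-d016's
`isOpen_map_restrictScalarsHom`).  An open `U ≤ G_F` is compact, so `j_F : U ⥲ j_F(U)` is an isomorphism of topological
groups (`subgroupMapContinuousMulEquiv`); `α` transports to `α' : j_F(U₁) ⥲ j_F(U₂)`; (H) for `α'`, `α'⁻¹` comes from
`h1219`; `hcore` gives `τ ∈ Γ`; and `τ_F := e⁻¹ ∘ τ ∘ e`, a RING automorphism of `AlgebraicClosure F`, satisfies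
`α(u)(τ_F x) = τ_F(u x)` — the conclusion of `NeukirchUchida F` — because `j_F σ • y = e (σ • e⁻¹ y)`.

Honest status: CONDITIONAL theorem — both binders are explicit; `hcore` is row R11's output (abc-iut-L4-d2), `h1219` is
abc-iut-w5-d055's (12.1.9) chain at base `ℚ`.  Nothing here bears on [IUTchIII] Cor. 3.12; no side is taken.

## References
* [NeukirchSchmidtWingberg2008] Neukirch–Schmidt–Wingberg, *Cohomology of Number Fields* (2nd ed.), Thm. (12.2.1).
* [MochizukiAbsAnab2004] S. Mochizuki, *Topics Surrounding the Anabelian Geometry of Hyperbolic Curves*, Thm. 1.1.3 p. 6.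
-/

noncomputable section

open Field IntermediateField
open scoped Pointwise

namespace Literature.AnabelianGeometry.AbsoluteAnabelian

open Literature.NumberTheory.GaloisRepresentations

universe u v w

/-! ### §1 Krull continuity of `restrictScalars` along a tower of TYPES `k → K → L` -/

section RestrictScalars

variable (k : Type u) (K : Type v) (L : Type w) [Field k] [Field K] [Field L] [Algebra k K] [Algebra K L]
  [Algebra k L] [IsScalarTower k K L]

/-- **`restrictScalarsHom k : Aut_K(L) → Aut_k(L)` is continuous** for the Krull topologies (no finiteness hypothesis: the
preimage of `Gal(L/E)`, `E/k` finite, contains `Gal(L/K(E))`, and `K(E)/K` is finite, generated by a `k`-basis of `E`).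
[cite: NeukirchSchmidtWingberg2008, Thm (12.2.1)] -/
theorem continuous_restrictScalarsHom :
    Continuous (AlgEquiv.restrictScalarsHom k : (L ≃ₐ[K] L) → (L ≃ₐ[k] L)) := by
  apply continuous_of_continuousAt_one _ (continuousAt_def.mpr _)
  intro N hN
  rw [map_one] at hN
  obtain ⟨E, hEfd, hE⟩ := (krullTopology_mem_nhds_one_iff k L N).mp hN
  haveI := hEfd
  let b := Module.finBasis k E
  let S : Set L := Set.range fun i => ((b i : E) : L)
  haveI : Finite S := (Set.finite_range _).to_subtype
  have hS : ∀ x ∈ S, IsIntegral K x := by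
    rintro _ ⟨i, rfl⟩
    have hi : IsIntegral k ((b i : E) : L) := (Algebra.IsIntegral.isIntegral (R := k) (b i)).map E.val
    exact hi.tower_top
  haveI : FiniteDimensional K (adjoin K S) := finiteDimensional_adjoin hS
  refine Filter.mem_of_superset ((krullTopology_mem_nhds_one_iff K L _).mpr
    ⟨adjoin K S, inferInstance, subset_rfl⟩) ?_
  intro σ hσ
  refine hE ?_
  rw [SetLike.mem_coe, IntermediateField.mem_fixingSubgroup_iff] at hσ ⊢
  intro x hx
  have hxS : x ∈ adjoin K S := by
    have hmem : (⟨x, hx⟩ : E) ∈ Submodule.span k (Set.range b) := by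
      rw [b.span_eq]; exact Submodule.mem_top
    suffices h : ∀ (y : E), y ∈ Submodule.span k (Set.range b) → (y : L) ∈ adjoin K S from h ⟨x, hx⟩ hmem
    intro y hy
    refine Submodule.span_induction (p := fun (y : E) _ => (y : L) ∈ adjoin K S) ?_ ?_ ?_ ?_ hy
    · rintro _ ⟨i, rfl⟩
      exact subset_adjoin K S ⟨i, rfl⟩
    · exact zero_mem _
    · intro y z _ _ hy hz
      exact add_mem hy hz
    · intro a y _ hy
      have e1 : ((a • y : E) : L) = (algebraMap k K a) • (y : L) := by
        rw [IntermediateField.coe_smul, algebraMap_smul]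
      rw [e1]
      exact (adjoin K S).toSubalgebra.smul_mem hy (algebraMap k K a)
  exact hσ x hxS

end RestrictScalars

/-! ### §2 The embedding `j_F : G_F →ₜ* Γ` -/

namespace NeukirchUchidaProof

section ToF

variable (F : Type) [Field F] [NumberField F]

/-- `AlgebraicClosure F` is an algebraic closure of `ℚ` (for the instance-search `ℚ`-algebra structure).
[cite: NeukirchSchmidtWingberg2008, Thm (12.2.1)] -/
theorem isAlgClosure_rat_algebraicClosure_numberField : IsAlgClosure ℚ (AlgebraicClosure F) :=
  ⟨AlgebraicClosure.isAlgClosed F, Algebra.IsAlgebraic.trans ℚ F (AlgebraicClosure F)⟩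

/-- **`e_F : AlgebraicClosure F ≃ₐ[ℚ] Ω₀`** — the closure of the number field `F` identified over `ℚ` with `Ω₀ = ℚ̄`
(Mathlib `IsAlgClosure.equiv`; a choice, fixed here; it is the isomorphism behind the tree's
`algEquivContinuousMulEquivAbsoluteGaloisGroup ℚ (AlgebraicClosure F)`). [cite: NeukirchSchmidtWingberg2008, Thm (12.2.1)] -/
def ratClosureEquiv : AlgebraicClosure F ≃ₐ[ℚ] AlgebraicClosure ℚ :=
  letI := isAlgClosure_rat_algebraicClosure_numberField F
  -- `ℚ̄` is an algebraic closure of `ℚ` also for the instance-search `ℚ`-algebra structure (definitionally Mathlib's)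
  letI : IsAlgClosure ℚ (AlgebraicClosure ℚ) := AlgebraicClosure.instIsAlgClosure ℚ
  IsAlgClosure.equiv ℚ (AlgebraicClosure F) (AlgebraicClosure ℚ)

/-- **`j_F : G_F →ₜ* Γ`** — `σ ↦ e_F ∘ σ|_ℚ ∘ e_F⁻¹`: restriction of scalars to `ℚ` (Mathlib `AlgEquiv.restrictScalarsHom`, continuous
by §1) followed by the tree's `Aut_ℚ(F̄) ≃ₜ* Γ`. [cite: NeukirchSchmidtWingberg2008, Thm (12.2.1)] -/
def absGaloisToRatOfField : absoluteGaloisGroup F →ₜ* absoluteGaloisGroup ℚ :=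
  letI := isAlgClosure_rat_algebraicClosure_numberField F
  { toMonoidHom :=
      (algEquivContinuousMulEquivAbsoluteGaloisGroup ℚ (AlgebraicClosure F)).toMulEquiv.toMonoidHom.comp
        ((AlgEquiv.restrictScalarsHom ℚ).comp (absoluteGaloisGroup.toAlgEquiv F).toMonoidHom)
    continuous_toFun :=
      (algEquivContinuousMulEquivAbsoluteGaloisGroup ℚ (AlgebraicClosure F)).continuous.comp
        ((continuous_restrictScalarsHom ℚ F (AlgebraicClosure F)).comp continuous_id) }

/-- The underlying map of `j_F`: `j_F σ = (Aut_ℚ(F̄) ≃ₜ* Γ) (σ|_ℚ)`. [cite: NeukirchSchmidtWingberg2008, Thm (12.2.1)] -/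
theorem absGaloisToRatOfField_apply (σ : absoluteGaloisGroup F) :
    absGaloisToRatOfField F σ =
      (letI := isAlgClosure_rat_algebraicClosure_numberField F
       algEquivContinuousMulEquivAbsoluteGaloisGroup ℚ (AlgebraicClosure F)
        ((AlgEquiv.restrictScalarsHom ℚ).comp (absoluteGaloisGroup.toAlgEquiv F).toMonoidHom σ)) :=
  rfl

/-- **The action formula**: `j_F σ • y = e_F (σ • e_F⁻¹ y)` for `y ∈ Ω₀`. [cite: NeukirchSchmidtWingberg2008, Thm (12.2.1)] -/
theorem absGaloisToRatOfField_smul (σ : absoluteGaloisGroup F) (y : AlgebraicClosure ℚ) :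
    absGaloisToRatOfField F σ • y = ratClosureEquiv F (σ • (ratClosureEquiv F).symm y) := by
  rfl

/-- `j_F` is injective. [cite: NeukirchSchmidtWingberg2008, Thm (12.2.1)] -/
theorem absGaloisToRatOfField_injective : Function.Injective (absGaloisToRatOfField F) := by
  letI := isAlgClosure_rat_algebraicClosure_numberField F
  intro σ τ h
  have h1 := (algEquivContinuousMulEquivAbsoluteGaloisGroup ℚ (AlgebraicClosure F)).injective h
  exact (absoluteGaloisGroup.toAlgEquiv F).injective (AlgEquiv.restrictScalarsHom_injective ℚ h1)

/-- `j_F` maps OPEN subgroups of `G_F` to OPEN subgroups of `Γ` (abc-iut-w4-d016's `isOpen_map_restrictScalarsHom`,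
pushed through the homeomorphism `Aut_ℚ(F̄) ≃ₜ* Γ`). [cite: NeukirchSchmidtWingberg2008, Thm (12.2.1)] -/
theorem isOpen_map_absGaloisToRatOfField (U : Subgroup (absoluteGaloisGroup F)) (hU : IsOpen (U : Set (absoluteGaloisGroup F))) :
    IsOpen ((U.map (absGaloisToRatOfField F).toMonoidHom : Subgroup (absoluteGaloisGroup ℚ)) :
      Set (absoluteGaloisGroup ℚ)) := by
  letI := isAlgClosure_rat_algebraicClosure_numberField F
  set ψ := algEquivContinuousMulEquivAbsoluteGaloisGroup ℚ (AlgebraicClosure F) with hψ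
  have hopen := isOpen_map_restrictScalarsHom U hU
  have heq : ((U.map (absGaloisToRatOfField F).toMonoidHom : Subgroup (absoluteGaloisGroup ℚ)) :
      Set (absoluteGaloisGroup ℚ)) =
      ψ.symm ⁻¹' ((U.map ((AlgEquiv.restrictScalarsHom ℚ).comp (absoluteGaloisGroup.toAlgEquiv F).toMonoidHom) :
        Subgroup (AlgebraicClosure F ≃ₐ[ℚ] AlgebraicClosure F)) : Set (AlgebraicClosure F ≃ₐ[ℚ] AlgebraicClosure F)) := by
    ext g
    simp only [Set.mem_preimage, SetLike.mem_coe, Subgroup.mem_map]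
    constructor
    · rintro ⟨σ, hσ, rfl⟩
      exact ⟨σ, hσ, (ψ.symm_apply_apply _).symm⟩
    · rintro ⟨σ, hσ, h⟩
      refine ⟨σ, hσ, ?_⟩
      have := congrArg ψ h
      rw [ψ.apply_symm_apply] at this
      exact this
  rw [heq]
  exact hopen.preimage ψ.symm.continuous

/-- An open subgroup of `G_F` carried isomorphically (as a TOPOLOGICAL group) onto its image under `j_F`: `U` is compact
(open, hence closed, in the compact group `G_F`), `j_F` is a continuous injection into a Hausdorff group.
[cite: NeukirchSchmidtWingberg2008, Thm (12.2.1)] -/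
def subgroupMapContinuousMulEquiv (U : Subgroup (absoluteGaloisGroup F)) (hU : IsOpen (U : Set (absoluteGaloisGroup F))) :
    U ≃ₜ* (U.map (absGaloisToRatOfField F).toMonoidHom : Subgroup (absoluteGaloisGroup ℚ)) :=
  haveI : CompactSpace U := isCompact_iff_compactSpace.mp (U.isClosed_of_isOpen hU).isCompact
  let e₀ : U ≃* (U.map (absGaloisToRatOfField F).toMonoidHom : Subgroup (absoluteGaloisGroup ℚ)) :=
    U.equivMapOfInjective _ (absGaloisToRatOfField_injective F)
  have hc : Continuous e₀ := ((absGaloisToRatOfField F).continuous.comp continuous_subtype_val).subtype_mk _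
  { e₀ with
    continuous_toFun := hc
    continuous_invFun := Continuous.continuous_symm_of_equiv_compact_to_t2 (f := e₀.toEquiv) hc }

/-- The underlying map: `(subgroupMapContinuousMulEquiv U u : Γ) = j_F u`. [cite: NeukirchSchmidtWingberg2008, Thm (12.2.1)] -/
@[simp] theorem coe_subgroupMapContinuousMulEquiv (U : Subgroup (absoluteGaloisGroup F))
    (hU : IsOpen (U : Set (absoluteGaloisGroup F))) (u : U) :
    ((subgroupMapContinuousMulEquiv F U hU u : (U.map (absGaloisToRatOfField F).toMonoidHom :
      Subgroup (absoluteGaloisGroup ℚ))) : absoluteGaloisGroup ℚ) = absGaloisToRatOfField F u :=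
  rfl

end ToF

/-! ### §3 The transport theorem -/

section Main

/-- **Neukirch–Uchida for every number field from the `ℚ`-core.**  HYPOTHESES (both explicit, classical):
`h1219` = [NSW] (12.1.9) at base `ℚ` in containment form — for open `U₁ U₂ ≤ Γ = Gal(ℚ̄/ℚ)` and `α : U₁ ⥲ U₂`, every
decomposition group `D_A ∩ U₁` is mapped INTO some `D_B ∩ U₂` (the binder of row R1, p446402, verbatim);
`hcore` = the `ℚ`-core of rows R1–R11 — under (H) for `α` and `α⁻¹`, `α` is conjugation by some `τ ∈ Γ`.
CONCLUSION: the tree's named fact `NeukirchUchida F` (p437013) for EVERY number field `F`: every topological isomorphism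
between open subgroups of `G_F` is induced by a field automorphism of `F̄`.  Transport along `j_F` (§2).
[cite: NeukirchSchmidtWingberg2008, Thm (12.2.1)] [cite: MochizukiAbsAnab2004, Thm 1.1.3 p.6] -/
theorem neukirchUchida_of_ratCore
    (h1219 : ∀ (V₁ V₂ : Subgroup (absoluteGaloisGroup ℚ)), IsOpen (V₁ : Set (absoluteGaloisGroup ℚ)) →
      IsOpen (V₂ : Set (absoluteGaloisGroup ℚ)) → ∀ β : V₁ ≃ₜ* V₂,
      ∀ A : ValuationSubring (AlgebraicClosure ℚ), A ≠ ⊤ →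
        ∃ B : ValuationSubring (AlgebraicClosure ℚ), B ≠ ⊤ ∧
          ((MulAction.stabilizer (absoluteGaloisGroup ℚ) A).subgroupOf V₁).map β.toMulEquiv.toMonoidHom ≤
            (MulAction.stabilizer (absoluteGaloisGroup ℚ) B).subgroupOf V₂)
    (hcore : ∀ (V₁ V₂ : Subgroup (absoluteGaloisGroup ℚ)), IsOpen (V₁ : Set (absoluteGaloisGroup ℚ)) →
      IsOpen (V₂ : Set (absoluteGaloisGroup ℚ)) → ∀ β : V₁ ≃ₜ* V₂,
      (∀ A : ValuationSubring (AlgebraicClosure ℚ), A ≠ ⊤ →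
        ∃ B : ValuationSubring (AlgebraicClosure ℚ), B ≠ ⊤ ∧
          ((MulAction.stabilizer (absoluteGaloisGroup ℚ) A).subgroupOf V₁).map β.toMulEquiv.toMonoidHom ≤
            (MulAction.stabilizer (absoluteGaloisGroup ℚ) B).subgroupOf V₂) →
      (∀ B : ValuationSubring (AlgebraicClosure ℚ), B ≠ ⊤ →
        ∃ A : ValuationSubring (AlgebraicClosure ℚ), A ≠ ⊤ ∧
          ((MulAction.stabilizer (absoluteGaloisGroup ℚ) B).subgroupOf V₂).map β.toMulEquiv.symm.toMonoidHom ≤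
            (MulAction.stabilizer (absoluteGaloisGroup ℚ) A).subgroupOf V₁) →
      ∃ τ : absoluteGaloisGroup ℚ, ∀ v : V₁, ((β v : V₂) : absoluteGaloisGroup ℚ) = τ * v * τ⁻¹)
    (F : Type) [Field F] [NumberField F] : NeukirchUchida F := by
  intro U₁ U₂ hU₁ hU₂ α
  -- the transported open subgroups of `Γ` and the transported isomorphism
  let j := absGaloisToRatOfField F
  let V₁ : Subgroup (absoluteGaloisGroup ℚ) := U₁.map j.toMonoidHom
  let V₂ : Subgroup (absoluteGaloisGroup ℚ) := U₂.map j.toMonoidHom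
  have hV₁ : IsOpen (V₁ : Set (absoluteGaloisGroup ℚ)) := isOpen_map_absGaloisToRatOfField F U₁ hU₁
  have hV₂ : IsOpen (V₂ : Set (absoluteGaloisGroup ℚ)) := isOpen_map_absGaloisToRatOfField F U₂ hU₂
  let ε₁ := subgroupMapContinuousMulEquiv F U₁ hU₁
  let ε₂ := subgroupMapContinuousMulEquiv F U₂ hU₂
  let β : V₁ ≃ₜ* V₂ := (ε₁.symm.trans α).trans ε₂
  have hβ : ∀ u : U₁, ((β (ε₁ u) : V₂) : absoluteGaloisGroup ℚ) = j ((α u : U₂) : absoluteGaloisGroup F) := by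
    intro u
    change ((ε₂ (α (ε₁.symm (ε₁ u))) : V₂) : absoluteGaloisGroup ℚ) = _
    rw [ContinuousMulEquiv.symm_apply_apply]
    rfl
  -- (H) for `β` and `β⁻¹` from (12.1.9) at base `ℚ`
  have hH := h1219 V₁ V₂ hV₁ hV₂ β
  have hH' : ∀ B : ValuationSubring (AlgebraicClosure ℚ), B ≠ ⊤ →
      ∃ A : ValuationSubring (AlgebraicClosure ℚ), A ≠ ⊤ ∧
        ((MulAction.stabilizer (absoluteGaloisGroup ℚ) B).subgroupOf V₂).map β.toMulEquiv.symm.toMonoidHom ≤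
          (MulAction.stabilizer (absoluteGaloisGroup ℚ) A).subgroupOf V₁ :=
    h1219 V₂ V₁ hV₂ hV₁ β.symm
  -- the ℚ-core
  obtain ⟨τ, hτ⟩ := hcore V₁ V₂ hV₁ hV₂ β hH hH'
  -- `j (α u) = τ * j u * τ⁻¹`
  have key : ∀ u : U₁, j ((α u : U₂) : absoluteGaloisGroup F) = τ * j (u : absoluteGaloisGroup F) * τ⁻¹ := by
    intro u
    rw [← hβ u, hτ (ε₁ u)]
    rfl
  -- the field automorphism `τ_F := e⁻¹ ∘ τ ∘ e`
  let e := ratClosureEquiv F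
  refine ⟨(e.toRingEquiv.trans (absoluteGaloisGroup.toAlgEquiv ℚ τ).toRingEquiv).trans e.symm.toRingEquiv, ?_⟩
  intro u x
  have h1 : ∀ (σ : absoluteGaloisGroup F) (z : AlgebraicClosure F), e (σ • z) = j σ • e z := by
    intro σ z
    rw [absGaloisToRatOfField_smul, AlgEquiv.symm_apply_apply]
  have hτF : ∀ z : AlgebraicClosure F,
      ((e.toRingEquiv.trans (absoluteGaloisGroup.toAlgEquiv ℚ τ).toRingEquiv).trans e.symm.toRingEquiv) z =
        e.symm (τ • e z) := fun z => rfl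
  apply e.injective
  rw [h1, hτF, hτF, AlgEquiv.apply_symm_apply, AlgEquiv.apply_symm_apply, key u, mul_smul, mul_smul,
    inv_smul_smul, ← h1]

end Main

end NeukirchUchidaProof

end Literature.AnabelianGeometry.AbsoluteAnabelian

end
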